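import Summits.BirchSwinnertonDyer.Rank1Residual.X11b.NeronIdentityReceptacle
import Literature.NumberTheory.EllipticCurves.KodairaNeronUnramifiedMultiplicativeBoundProofs
import Literature.NumberTheory.EllipticCurves.KodairaNeronUnramifiedAdditiveThreeProofs
import Literature.NumberTheory.EllipticCurves.IwasawaSelmerControlAwayFromPProofs
import HarnessLib

/-!
# X11b (team N8/O2): Kodaira–Néron exponents INTO the receptacle `E⁰(K̄_v)` — at a multiplicative
# place `ord_v(Δ_min) • Q ∈ E⁰(K̄_v)`, at an additive place `c • Q ∈ E⁰(K̄_v)` with `c ≤ 4`, for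
# every point `Q ∈ E(K̄_v)` fixed by the local inertia group

HONEST FRAMING (cell `b2b-bsdres`, run/shared/lean/b2b/bsd-rank1-residual/, verbatim in every
file): the goal of the cell is to DELETE the COMBINATION-SHAPED residual classes of the
Birch–Swinnerton-Dyer formula for ALL analytic-rank `≤ 1` elliptic curves over `ℚ` — "full BSD
formula for every rank `≤ 1` curve in class `C`" assembled STRICTLY from published theorems — so
that the rank-`≤ 1` remainder becomes exactly the CONSTRUCTION-SHAPED classes, which are TYPED
(missing-input `Prop`s), NOT attempted. This is not "finishing BSD". Team N8/O2 = `x11b3`, seat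
`b2b-bsdres-x11b3-p2` (GEN 33). THEOREMS ONLY (no definition, no named fact, no `sorry`); nothing
is `p`-specific; nothing booked; no mark / label / count / tier moves.

## What

`X11b.E0Receptacle W v = E⁰(K̄_v)` (x11b3-p2 GEN 3, `X11b/NeronIdentityReceptacle`) is the receptacle
of the cite-only binder `hGZ` = [GZ86, III (3.1)] of the cell's Kolyvagin files (Gross 1991,
Prop. 6.2 (1) at `v ∣ N`: the Heegner points reduce into the identity component). This file
proves the TAMAGAWA-EXPONENT half of that clause, with NO Heegner input: by the theorem of
Kodaira–Néron over `K_v^nr` (Silverman *AEC* Thm. VII.6.1 / Cor. VII.6.2; *ATAEC* Cor. IV.9.2(d);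
tree `KodairaNeronUnramified*Proofs`), for every point `Q ∈ E(K̄_v)` fixed by the inertia group
`I_𝔐 ≤ Γ_{K_v}` (i.e. every point of `E(K_v^nr)`):

* `X11b.ordMinimalDiscriminant_nsmul_mem_E0Receptacle` — at a place of MULTIPLICATIVE reduction,
  `ord_v(Δ_min) • Q ∈ E⁰(K̄_v)` (`[E(K_v^nr) : E₀(K_v^nr)] = v(Δ)`, tree
  `WeierstrassCurve.ordΔ_nsmul_reducesToNonsingular_of_hasMultiplicativeReduction`);
* `X11b.exists_nsmul_mem_E0Receptacle_le_four` — at a place of ADDITIVE reduction there is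
  `0 < c ≤ 4` with `c • Q ∈ E⁰(K̄_v)` for all such `Q` (tree
  `WeierstrassCurve.exists_nsmul_reducesToNonsingular_le_four_of_hasAdditiveReduction`);
* `X11b.exists_nsmul_mem_E0Receptacle_not_three_dvd` — the same with `3 ∤ c` when the Kodaira type
  `W.kodairaSymbolAt v` is neither IV nor IV* (*ATAEC* Table 4.1; tree
  `WeierstrassCurve.exists_nsmul_reducesToNonsingular_not_three_dvd_of_hasAdditiveReduction`);

after two folklore transports for the CHOSEN witnesses `w₀, ι₀, C₀` of the receptacle:
`X11b.mem_E0Receptacle_iff_reducesToNonsingular` (membership = nonsingular reduction for `|·|_v`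
of the transported point on the minimal model `X = M ⊗ K_v`) and
`X11b.E0Receptacle_transport_smul` (the transport is `Γ_{K_v}`-equivariant, the change of
variables `C₀` being defined over `K_v`).

Consumer: `X11b/KolyvaginHGZOfKodairaNeron` — the clause `hGZ` of
`KolyvaginHloc.hloc_concrete_of_GZ31` / `KolyvaginAssembly.hpoints_of_perLevelChoice` at every
prime `p` not dividing the exponents (cite-only [GZ86, III (3.1)] is then needed only at the
primes `p ∣ ord_v(Δ_min)` of a multiplicative `v`, and at `p = 3` of an additive `v`).

References (locators only; no new fact): [cite: SilvermanAEC2009, Thm. VII.6.1, Cor. VII.6.2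
(PDF p. 177), VII.§2 Prop. 2.1] [cite: SilvermanATAEC1994, Cor. IV.9.2(d) (PDF p. 340)]
[cite: GrossZagier1986, III (3.1)] [cite: GrossLMS1991, Prop. 6.2 (1)].

presearch: Kodaira–Néron exponent into `E⁰` — [corpus: SilvermanAEC2009 VII.6.1] the printed
theorem; tree `KodairaNeronUnramifiedAdditiveBoundProofs` / `KodairaNeronMultiplicativeProofs`
(`lean search 'exists_nsmul_reducesToNonsingular|E0Receptacle'`); no second treatment needed.

## Design

THEOREMS ONLY; `noncomputable section`; `open scoped Classical NNReal`; namespace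
`Summit.BirchSwinnertonDyer.Rank1Residual.X11b`; the chosen witnesses are spelled out as the
`Classical.choose` terms of `X11b/NeronIdentityReceptacle` (no auxiliary definition). Axioms:
`propext`, `Classical.choice`, `Quot.sound`.
-/

noncomputable section

open scoped Classical NNReal
open NumberField IsDedekindDomain Field

namespace Summit.BirchSwinnertonDyer.Rank1Residual.X11b

open WeierstrassCurve Literature.NumberTheory.EllipticCurves Literature.NumberTheory.GaloisRepresentations
  IsDedekindDomain.HeightOneSpectrum Literature.NumberTheory.DiophantineGeometry
  Literature.NumberTheory.DiophantineGeometry.TateAlgorithm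

universe u

variable {K : Type u} [Field K] [NumberField K] (W : WeierstrassCurve K)
  (v : HeightOneSpectrum (𝓞 K))

/-! ## The transport of the receptacle, unfolded -/

/-- **Membership in `E⁰(K̄_v)` = nonsingular reduction for `|·|_v` on the minimal model.** For
`Q ∈ E(K̄_v)`: `Q ∈ E0Receptacle W v` iff the transported point
`C₀ • Q ∈ X(K̄_v)`, `X = M ⊗ K_v` (`M = W.localMinimalIntegralModel v`, `C₀` the chosen change of
variables to the minimal model), has `ReducesToNonsingular` for the chosen spectral valuation `w₀`
(bridge `reducesToNonsingular_iff_hasNonsingularReduction` on the `𝒪_{w₀}`-model `M.map ι₀`).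
[cite: SilvermanAEC2009, VII.§2 Prop. 2.1] -/
theorem mem_E0Receptacle_iff_reducesToNonsingular (Q : localPoints W (v.adicCompletion K)) :
    Q ∈ E0Receptacle W v ↔
      ReducesToNonsingular (v.exists_spectralValuation).choose
        (IsLocalRing.residue (v.exists_spectralValuation).choose.integer)
        (Affine.Point.congrEquiv (congrArg (fun X : WeierstrassCurve (v.adicCompletion K) ↦
            X.baseChange (AlgebraicClosure (v.adicCompletion K)))
            (W.exists_variableChange_eq_localMinimalIntegralModel v).choose_spec)
          (VariableChange.pointEquivBaseChange (W.baseChange (v.adicCompletion K))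
            (W.exists_variableChange_eq_localMinimalIntegralModel v).choose
            (AlgebraicClosure (v.adicCompletion K))
            (Affine.Point.congrEquiv (baseChange_baseChange_adicCompletion W v).symm Q))) := by
  rw [mem_E0Receptacle_iff, ← reducesToNonsingular_iff_hasNonsingularReduction,
    Literature.NumberTheory.EllipticCurves.reducesToNonsingular_congrEquiv_iff]

/-- **The transport to the minimal model is `Γ_{K_v}`-equivariant** (`C₀` has coefficients in
`K_v`; Silverman *AEC* VII.§1, VIII.§1; the construction of the tree's
`exists_addEquiv_localPoints_of_smul_eq`, here for the CHOSEN `C₀` of the receptacle). [folklore] -/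
theorem E0Receptacle_transport_smul (σ : absoluteGaloisGroup (v.adicCompletion K))
    (Q : localPoints W (v.adicCompletion K)) :
    Affine.Point.congrEquiv (congrArg (fun X : WeierstrassCurve (v.adicCompletion K) ↦
          X.baseChange (AlgebraicClosure (v.adicCompletion K)))
          (W.exists_variableChange_eq_localMinimalIntegralModel v).choose_spec)
        (VariableChange.pointEquivBaseChange (W.baseChange (v.adicCompletion K))
          (W.exists_variableChange_eq_localMinimalIntegralModel v).choose
          (AlgebraicClosure (v.adicCompletion K))
          (Affine.Point.congrEquiv (baseChange_baseChange_adicCompletion W v).symm (σ • Q))) =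
      Affine.Point.map ((absoluteGaloisGroup.toAlgEquiv _ σ :
          AlgebraicClosure (v.adicCompletion K) ≃ₐ[v.adicCompletion K]
            AlgebraicClosure (v.adicCompletion K)) :
          AlgebraicClosure (v.adicCompletion K) →ₐ[v.adicCompletion K]
            AlgebraicClosure (v.adicCompletion K))
        (Affine.Point.congrEquiv (congrArg (fun X : WeierstrassCurve (v.adicCompletion K) ↦
            X.baseChange (AlgebraicClosure (v.adicCompletion K)))
            (W.exists_variableChange_eq_localMinimalIntegralModel v).choose_spec)
          (VariableChange.pointEquivBaseChange (W.baseChange (v.adicCompletion K))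
            (W.exists_variableChange_eq_localMinimalIntegralModel v).choose
            (AlgebraicClosure (v.adicCompletion K))
            (Affine.Point.congrEquiv (baseChange_baseChange_adicCompletion W v).symm Q))) := by
  rw [congrEquiv_smul, VariableChange.pointEquivBaseChange_map_algEquiv]
  exact Affine.Point.congrEquiv_baseChange_map
    (W.exists_variableChange_eq_localMinimalIntegralModel v).choose_spec _ _

/-- The transported point of an `I_𝔐`-fixed `Q ∈ E(K̄_v)` is `I_𝔐`-fixed in `X(K̄_v)`. [folklore] -/
theorem E0Receptacle_transport_eq_of_forall_inertia {𝔐 : Ideal (localAbsIntegers v)}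
    {Q : localPoints W (v.adicCompletion K)}
    (hQ : ∀ σ ∈ 𝔐.inertia (absoluteGaloisGroup (v.adicCompletion K)), σ • Q = Q) :
    ∀ σ ∈ 𝔐.inertia (absoluteGaloisGroup (v.adicCompletion K)),
      Affine.Point.map ((absoluteGaloisGroup.toAlgEquiv _ σ :
          AlgebraicClosure (v.adicCompletion K) ≃ₐ[v.adicCompletion K]
            AlgebraicClosure (v.adicCompletion K)) :
          AlgebraicClosure (v.adicCompletion K) →ₐ[v.adicCompletion K]
            AlgebraicClosure (v.adicCompletion K))
        (Affine.Point.congrEquiv (congrArg (fun X : WeierstrassCurve (v.adicCompletion K) ↦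
            X.baseChange (AlgebraicClosure (v.adicCompletion K)))
            (W.exists_variableChange_eq_localMinimalIntegralModel v).choose_spec)
          (VariableChange.pointEquivBaseChange (W.baseChange (v.adicCompletion K))
            (W.exists_variableChange_eq_localMinimalIntegralModel v).choose
            (AlgebraicClosure (v.adicCompletion K))
            (Affine.Point.congrEquiv (baseChange_baseChange_adicCompletion W v).symm Q))) =
        Affine.Point.congrEquiv (congrArg (fun X : WeierstrassCurve (v.adicCompletion K) ↦
            X.baseChange (AlgebraicClosure (v.adicCompletion K)))
            (W.exists_variableChange_eq_localMinimalIntegralModel v).choose_spec)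
          (VariableChange.pointEquivBaseChange (W.baseChange (v.adicCompletion K))
            (W.exists_variableChange_eq_localMinimalIntegralModel v).choose
            (AlgebraicClosure (v.adicCompletion K))
            (Affine.Point.congrEquiv (baseChange_baseChange_adicCompletion W v).symm Q)) := by
  intro σ hσ
  rw [← E0Receptacle_transport_smul, hQ σ hσ]

/-! ## The minimal model `X = M ⊗ K_v` -/

-- `M ⊗ K_v = W.localMinimalModel v` and its ellipticity are the tree's
-- `WeierstrassCurve.map_localMinimalIntegralModel_eq` / `WeierstrassCurve.isElliptic_map_localMinimalIntegralModel`
-- (`IwasawaSelmerControlAwayFromPProofs`), reused below (gate dedup).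

/-- The integral model of `X = M ⊗ K_v` is `M` (`𝓞_v → K_v` is injective). [folklore] -/
theorem integralModel_map_localMinimalIntegralModel_eq
    [((W.localMinimalIntegralModel v).map (algebraMap (v.adicCompletionIntegers K)
      (v.adicCompletion K))).IsIntegral (v.adicCompletionIntegers K)] :
    ((W.localMinimalIntegralModel v).map (algebraMap (v.adicCompletionIntegers K)
      (v.adicCompletion K))).integralModel (v.adicCompletionIntegers K) =
        W.localMinimalIntegralModel v := by
  apply WeierstrassCurve.map_injective
    (IsFractionRing.injective (v.adicCompletionIntegers K) (v.adicCompletion K))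
  exact baseChange_integralModel_eq (v.adicCompletionIntegers K) _

/-- `ord_v(Δ_min)` is the `𝓂_v`-adic order of the discriminant of the integral model of `X`.
[folklore] -/
theorem ordMinimalDiscriminant_eq_toNat_addVal
    [((W.localMinimalIntegralModel v).map (algebraMap (v.adicCompletionIntegers K)
      (v.adicCompletion K))).IsIntegral (v.adicCompletionIntegers K)] :
    W.ordMinimalDiscriminant v =
      (IsDiscreteValuationRing.addVal (v.adicCompletionIntegers K)
        (((W.localMinimalIntegralModel v).map (algebraMap (v.adicCompletionIntegers K)
          (v.adicCompletion K))).integralModel (v.adicCompletionIntegers K)).Δ).toNat := by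
  rw [integralModel_map_localMinimalIntegralModel_eq]
  rfl

/-- The Tate type of the integral model of `X` is `W.kodairaSymbolAt v` (`kodairaSymbolAt_def`).
[folklore] -/
theorem kodairaSymbolOfMinimal_integralModel_map_eq_kodairaSymbolAt
    [((W.localMinimalIntegralModel v).map (algebraMap (v.adicCompletionIntegers K)
      (v.adicCompletion K))).IsIntegral (v.adicCompletionIntegers K)] :
    (((W.localMinimalIntegralModel v).map (algebraMap (v.adicCompletionIntegers K)
      (v.adicCompletion K))).integralModel (v.adicCompletionIntegers K)).kodairaSymbolOfMinimal =
        W.kodairaSymbolAt v := by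
  rw [integralModel_map_localMinimalIntegralModel_eq, kodairaSymbolAt_def]

/-! ## Kodaira–Néron exponents into `E⁰(K̄_v)` -/

/-- **At a multiplicative place, `ord_v(Δ_min) • Q ∈ E⁰(K̄_v)` for every `I_𝔐`-fixed
`Q ∈ E(K̄_v)`** (Kodaira–Néron over `K_v^nr`, Silverman *AEC* Thm. VII.6.1: for split
multiplicative reduction — every multiplicative reduction is split over `K_v^nr` —
`E(K)/E₀(K)` is cyclic of order `v(Δ)`; tree
`WeierstrassCurve.ordΔ_nsmul_reducesToNonsingular_of_hasMultiplicativeReduction` on the minimal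
model `X = M ⊗ K_v`, transported into the receptacle). No Heegner input: the component-group
exponent half of [GZ86, III (3.1)] as Gross 1991, Prop. 6.2 (1) uses it.
[cite: SilvermanAEC2009, Thm. VII.6.1 with Cor. VII.6.2 (PDF p. 177)]
[cite: SilvermanATAEC1994, Cor. IV.9.2(d) (PDF p. 340)] -/
theorem ordMinimalDiscriminant_nsmul_mem_E0Receptacle [W.IsElliptic]
    (hv : W.HasMultiplicativeReductionAt v) {𝔐 : Ideal (localAbsIntegers v)}
    (h𝔐 : 𝔐 ∈ v.localPrimesAbove) {Q : localPoints W (v.adicCompletion K)}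
    (hQ : ∀ σ ∈ 𝔐.inertia (absoluteGaloisGroup (v.adicCompletion K)), σ • Q = Q) :
    W.ordMinimalDiscriminant v • Q ∈ E0Receptacle W v := by
  haveI := W.isElliptic_map_localMinimalIntegralModel (v := v)
  haveI hmult : ((W.localMinimalIntegralModel v).map (algebraMap (v.adicCompletionIntegers K)
      (v.adicCompletion K))).HasMultiplicativeReduction (v.adicCompletionIntegers K) := by
    rw [W.map_localMinimalIntegralModel_eq (v := v)]; exact hv
  have hKN := (((W.localMinimalIntegralModel v).map (algebraMap (v.adicCompletionIntegers K)
      (v.adicCompletion K))).ordΔ_nsmul_reducesToNonsingular_of_hasMultiplicativeReduction hmult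
    (v.exists_spectralValuation).choose (v.exists_spectralValuation).choose_spec h𝔐).2 _
    (E0Receptacle_transport_eq_of_forall_inertia W v hQ)
  rw [← ordMinimalDiscriminant_eq_toNat_addVal, ← map_nsmul, ← map_nsmul, ← map_nsmul] at hKN
  exact (mem_E0Receptacle_iff_reducesToNonsingular W v _).mpr hKN

/-- **At an additive place there is `0 < c ≤ 4` with `c • Q ∈ E⁰(K̄_v)` for every `I_𝔐`-fixed
`Q ∈ E(K̄_v)`** (Kodaira–Néron over `K_v^nr`, Silverman *AEC* Thm. VII.6.1: "in all other
cases `E(K)/E₀(K)` is finite of order at most `4`"; tree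
`WeierstrassCurve.exists_nsmul_reducesToNonsingular_le_four_of_hasAdditiveReduction` on the
minimal model, transported into the receptacle). [cite: SilvermanAEC2009, Thm. VII.6.1 (PDF p. 177)]
[cite: SilvermanATAEC1994, Cor. IV.9.2(d) with Table 4.1 (PDF pp. 340, 365)] -/
theorem exists_nsmul_mem_E0Receptacle_le_four [W.IsElliptic]
    (hv : W.HasAdditiveReductionAt v) {𝔐 : Ideal (localAbsIntegers v)}
    (h𝔐 : 𝔐 ∈ v.localPrimesAbove) :
    ∃ c : ℕ, 0 < c ∧ c ≤ 4 ∧ ∀ Q : localPoints W (v.adicCompletion K),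
      (∀ σ ∈ 𝔐.inertia (absoluteGaloisGroup (v.adicCompletion K)), σ • Q = Q) →
        c • Q ∈ E0Receptacle W v := by
  haveI := W.isElliptic_map_localMinimalIntegralModel (v := v)
  haveI hadd : ((W.localMinimalIntegralModel v).map (algebraMap (v.adicCompletionIntegers K)
      (v.adicCompletion K))).HasAdditiveReduction (v.adicCompletionIntegers K) := by
    rw [W.map_localMinimalIntegralModel_eq (v := v)]; exact hv
  obtain ⟨c, hc0, hc4, hKN⟩ := ((W.localMinimalIntegralModel v).map
      (algebraMap (v.adicCompletionIntegers K)
      (v.adicCompletion K))).exists_nsmul_reducesToNonsingular_le_four_of_hasAdditiveReduction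
    (v.exists_spectralValuation).choose (v.exists_spectralValuation).choose_spec h𝔐
  refine ⟨c, hc0, hc4, fun Q hQ ↦ ?_⟩
  have h := hKN _ (E0Receptacle_transport_eq_of_forall_inertia W v hQ)
  rw [← map_nsmul, ← map_nsmul, ← map_nsmul] at h
  exact (mem_E0Receptacle_iff_reducesToNonsingular W v _).mpr h

/-- **At an additive place of Kodaira type `∉ {IV, IV*}` there is `0 < c ≤ 4` with `3 ∤ c` and
`c • Q ∈ E⁰(K̄_v)` for every `I_𝔐`-fixed `Q ∈ E(K̄_v)`** (Kodaira–Néron over `K_v^nr`; Silverman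
*ATAEC* Table 4.1: `c̄ = 1, 2, 4, 4, 2, 1` for II, III, I₀*, Iₙ*, III*, II*; tree
`WeierstrassCurve.exists_nsmul_reducesToNonsingular_not_three_dvd_of_hasAdditiveReduction`,
transported into the receptacle). [cite: SilvermanATAEC1994, Cor. IV.9.2(d) with Table 4.1 (PDF pp. 340, 365)]
[cite: SilvermanAEC2009, Thm. VII.6.1 (PDF p. 177)] -/
theorem exists_nsmul_mem_E0Receptacle_not_three_dvd [W.IsElliptic]
    (hv : W.HasAdditiveReductionAt v) (hIV : W.kodairaSymbolAt v ≠ KodairaSymbol.IV)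
    (hIVs : W.kodairaSymbolAt v ≠ KodairaSymbol.IVstar) {𝔐 : Ideal (localAbsIntegers v)}
    (h𝔐 : 𝔐 ∈ v.localPrimesAbove) :
    ∃ c : ℕ, 0 < c ∧ c ≤ 4 ∧ ¬ 3 ∣ c ∧ ∀ Q : localPoints W (v.adicCompletion K),
      (∀ σ ∈ 𝔐.inertia (absoluteGaloisGroup (v.adicCompletion K)), σ • Q = Q) →
        c • Q ∈ E0Receptacle W v := by
  haveI := W.isElliptic_map_localMinimalIntegralModel (v := v)
  haveI hadd : ((W.localMinimalIntegralModel v).map (algebraMap (v.adicCompletionIntegers K)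
      (v.adicCompletion K))).HasAdditiveReduction (v.adicCompletionIntegers K) := by
    rw [W.map_localMinimalIntegralModel_eq (v := v)]; exact hv
  have hIV' := hIV
  have hIVs' := hIVs
  rw [← kodairaSymbolOfMinimal_integralModel_map_eq_kodairaSymbolAt] at hIV' hIVs'
  obtain ⟨c, hc0, hc4, hc3, hKN⟩ := ((W.localMinimalIntegralModel v).map
      (algebraMap (v.adicCompletionIntegers K)
      (v.adicCompletion K))).exists_nsmul_reducesToNonsingular_not_three_dvd_of_hasAdditiveReduction
    hIV' hIVs' (v.exists_spectralValuation).choose (v.exists_spectralValuation).choose_spec h𝔐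
  refine ⟨c, hc0, hc4, hc3, fun Q hQ ↦ ?_⟩
  have h := hKN _ (E0Receptacle_transport_eq_of_forall_inertia W v hQ)
  rw [← map_nsmul, ← map_nsmul, ← map_nsmul] at h
  exact (mem_E0Receptacle_iff_reducesToNonsingular W v _).mpr h

end Summit.BirchSwinnertonDyer.Rank1Residual.X11b

end
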